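import Summits.Ventures.Crystal3D.TopCut.CapSOSSound
import Summits.Ventures.Crystal3D.Bulk.CapX2CheckI
import HarnessLib

/-!
# X2 cap certificates by sum-of-squares identities, I: integer expansions of the pole parts

Venture `Crystal3D` (cell `pub-crystal3d`, phase 2; seat p2). The pole-augmented («X2») cap
certificates of seat p1 (`Bulk/CapX2Cert.lean`: an `X2Cert` `c` proves `NoHole (-c.u₀)` once (N),
(I) `Dtot ≤ M`, (II) `P ≤ -λ` on `Δ(u₀, ½)`, (III) `S₃ ≤ ε₃` on `R₃(½)` hold; (N) is decidable and (I)
is a kernel computation by `Bulk/CapX2CheckI.lean`) leave the two TRIVARIATE inequalities (II), (III)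
as hypotheses. This series (`X2SOSExpand` → `X2SOSCheck` → `X2SOSSound`) makes them kernel computations
WITHOUT subdivision, exactly as `TopCut/CapSOSCheck.lean` did for plain cap certificates: Putinar-type
identities in exact integer arithmetic over the tree's reflective polynomial library. THIS FILE:

* `QIsub A B C k` — the integer three-point table `QI3 k` (`= c_k · Q3 k`) with the variables
  replaced by polynomials `A, B, C` (`eval_QIsub`), by the same Chebyshev recurrence;
* `PoleBlk`, `polePPoly`, `poleSPoly` — the INTEGER expansions of the pole parts of the pair
  polynomial `P - K = S11(1,t,t) + S11(t,1,t) + S11(t,t,1) + S12(t,-u,-v) + S12(t,-v,-u)` and of the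
  triple polynomial `S₃ = S11(u,v,t) + S11(u,t,v) + S11(v,t,u)` from integer column polynomials
  (`φᵃ_{k,r} = N_k · a_{k,r}`, `φᵇ_{k,r} = N_k · b_{k,r}`), their real values `polePval` / `poleSval`
  (`eval_polePPoly`, `eval_poleSPoly`), and chunk checks (`pieceOK`, one `decide` per chunk) with
  their composition (`PolePValid`, `PoleSValid`).

Everything computational is `List`/`ℤ`/`ℕ` structural recursion (`decide +kernel`, standard axioms).
HONEST FRAMING: definitions and their evaluation lemmas only [folklore]; NO certificate is asserted here.
-/

noncomputable section

open Finset
open Literature.Geometry.DiscreteGeometry Literature.Geometry.DiscreteGeometry.PolyCert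
open Literature.Geometry.DiscreteGeometry.PolyCert.SPoly
open Literature.Geometry.DiscreteGeometry.BachocVallentin
open Literature.Analysis.SpecialFunctions
open Summit.Ventures.PackingBounds.ThreePointCert
open Summit.Ventures.Crystal3D.CapSOS Summit.Ventures.Crystal3D.CapX2

namespace Summit.Ventures.Crystal3D.X2SOS

/-! ### `Q3 k` at polynomial arguments (integer-scaled) -/

/-- `σ(A,B,C) = 2(C - A·B)`. [folklore] -/
def sigS (A B Cc : SPoly) : SPoly := smul 2 (Cc ++ neg (mulN A B))

/-- `π(A,B) = (1 - A²)(1 - B²)`. [folklore] -/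
def piS (A B : SPoly) : SPoly := mulN (C 1 ++ neg (mulN A A)) (C 1 ++ neg (mulN B B))

/-- `eval (sigS A B C) = 2 (C - A B)`. [folklore] -/
@[simp] theorem eval_sigS (A B Cc : SPoly) (u v t : ℝ) :
    eval (sigS A B Cc) u v t = 2 * (eval Cc u v t - eval A u v t * eval B u v t) := by
  simp [sigS]; ring

/-- `eval (piS A B) = (1 - A²)(1 - B²)`. [folklore] -/
@[simp] theorem eval_piS (A B : SPoly) (u v t : ℝ) :
    eval (piS A B) u v t = (1 - eval A u v t ^ 2) * (1 - eval B u v t ^ 2) := by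
  simp [piS]; ring

/-- `QIsub A B C k`: the table `QI3 k` with `(u,v,t) ↦ (A,B,C)` (same recurrence). [folklore] -/
def QIsub (A B Cc : SPoly) : ℕ → SPoly
  | 0 => C 1
  | 1 => normalize (sigS A B Cc)
  | 2 => normalize (mulN (sigS A B Cc) (sigS A B Cc) ++ smul (-2) (piS A B))
  | j + 3 => normalize (mulN (sigS A B Cc) (QIsub A B Cc (j + 2)) ++
      neg (mulN (piS A B) (QIsub A B Cc (j + 1))))

/-- `eval (QIsub A B C k) = c_k · Q3 k (A) (B) (C)`. [folklore] -/
theorem eval_QIsub (A B Cc : SPoly) (k : ℕ) (u v t : ℝ) :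
    eval (QIsub A B Cc k) u v t =
      (cfac3 k : ℝ) * Q3 k (eval A u v t) (eval B u v t) (eval Cc u v t) := by
  induction k using Nat.strongRecOn with
  | ind k ih =>
    match k with
    | 0 => simp [QIsub, cfac3, Q3, chebHom]
    | 1 =>
      rw [QIsub, eval_normalize, eval_sigS]
      simp only [cfac3, Q3, chebHom]
      push_cast; ring
    | 2 =>
      rw [QIsub, eval_normalize, eval_append, eval_mulN, eval_smul, eval_sigS, eval_piS]
      simp only [cfac3, Q3, chebHom]
      push_cast; ring
    | j + 3 =>
      have h1 := ih (j + 1) (by omega)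
      have h2 := ih (j + 2) (by omega)
      rw [QIsub, eval_normalize, eval_append, eval_mulN, eval_neg, eval_mulN, h1, h2, eval_sigS,
        eval_piS]
      simp only [cfac3, Q3, chebHom]
      have e1 : (j + 1 = 0) = False := by simp
      have e2 : (j + 2 = 0) = False := by simp
      have e3 : (j + 3 = 0) = False := by simp
      simp only [e1, e2, e3, if_false]
      push_cast; ring

/-! ### Column polynomials -/

/-- `φ_w(t) = Σ_a w_a t^a` as a term list. [folklore] -/
def phiT (w : List ℤ) : SPoly := (List.range w.length).map fun a => (⟨0, 0, a⟩, w.getD a 0)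

/-- `eval (phiT w) = φ_w(t)`. [folklore] -/
theorem eval_phiT (w : List ℤ) (u v t : ℝ) : eval (phiT w) u v t = phiW w t := by
  rw [phiT, SPoly.eval, List.map_map, list_sum_map_range, phiW]
  refine Finset.sum_congr rfl fun a _ => ?_
  simp [Mono.eval]

/-- Sign flip of the odd coefficients: `φ_{altNeg w}(x) = φ_w(-x)`. [folklore] -/
def altNeg : List ℤ → List ℤ
  | [] => []
  | z :: zs => z :: (altNeg zs).map fun x => -x

/-- `φ` of a negated list is `-φ`. [folklore] -/
theorem phiW_map_neg (l : List ℤ) (x : ℝ) : phiW (l.map fun y => -y) x = -phiW l x := by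
  induction l with
  | nil => simp [phiW_nil]
  | cons z zs ih => rw [List.map_cons, phiW_cons, phiW_cons, ih]; push_cast; ring

/-- `φ_{altNeg w}(x) = φ_w(-x)`. [folklore] -/
theorem phiW_altNeg : ∀ (w : List ℤ) (x : ℝ), phiW (altNeg w) x = phiW w (-x) := by
  intro w
  induction w with
  | nil => intro x; simp [altNeg, phiW_nil]
  | cons z zs ih => intro x; rw [altNeg, phiW_cons, phiW_cons, phiW_map_neg, ih]; ring

/-- `φ_w(1) = Σ w`. [folklore] -/
theorem phiW_one : ∀ w : List ℤ, phiW w 1 = ((w.sum : ℤ) : ℝ) := by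
  intro w
  induction w with
  | nil => simp [phiW_nil]
  | cons z zs ih => rw [phiW_cons, ih, List.sum_cons]; push_cast; ring

/-! ### Integer expansions of the pole parts -/

/-- One pole block: degree `k`, integer scale `s`, columns `(φᵃ_r, φᵇ_r)` (coefficient lists). [folklore] -/
structure PoleBlk where
  /-- the degree `k` -/
  k : ℕ
  /-- integer scale `s_k` -/
  s : ℕ
  /-- columns: pairs of integer coefficient lists `(φᵃ_{k,r}, φᵇ_{k,r})` -/
  cols : List (List ℤ × List ℤ)
deriving DecidableEq

/-- Pole part of the PAIR polynomial, one block: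
`s · [ (Σ_r φᵃ_r(1)φᵃ_r(t))·(Q(1,t,t) + Q(t,1,t)) + (Σ_r φᵃ_r(t)²)·Q(t,t,1) + (Σ_r φᵃ_r(t)φᵇ_r(-u))·Q(t,-u,-v)
 + (Σ_r φᵃ_r(t)φᵇ_r(-v))·Q(t,-v,-u) ]` (tables `QIsub`, built once per block). [folklore] -/
def polePb (b : PoleBlk) : SPoly :=
  smul (b.s : ℤ) (mergeAll [
    mulN (mergeAll (b.cols.map fun ab => smul ab.1.sum (phiT ab.1)))
      (QIsub (C 1) T T b.k ++ QIsub T (C 1) T b.k),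
    mulN (mergeAll (b.cols.map fun ab => mulN (phiT ab.1) (phiT ab.1))) (QIsub T T (C 1) b.k),
    mulN (mergeAll (b.cols.map fun ab => mulN (phiT ab.1) (phiU (altNeg ab.2))))
      (QIsub T (neg U) (neg V) b.k),
    mulN (mergeAll (b.cols.map fun ab => mulN (phiT ab.1) (phiV (altNeg ab.2))))
      (QIsub T (neg V) (neg U) b.k)])

/-- Pole part of the TRIPLE polynomial, one block:
`s · [ (Σ_r φᵃ_r(u)φᵃ_r(v))·Q(u,v,t) + (Σ_r φᵃ_r(u)φᵃ_r(t))·Q(u,t,v) + (Σ_r φᵃ_r(v)φᵃ_r(t))·Q(v,t,u) ]`.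
[folklore] -/
def poleSb (b : PoleBlk) : SPoly :=
  smul (b.s : ℤ) (mergeAll [
    mulN (mergeAll (b.cols.map fun ab => mulN (phiU ab.1) (phiV ab.1))) (QI3 b.k),
    mulN (mergeAll (b.cols.map fun ab => mulN (phiU ab.1) (phiT ab.1))) (QIsub U T V b.k),
    mulN (mergeAll (b.cols.map fun ab => mulN (phiV ab.1) (phiT ab.1))) (QIsub V T U b.k)])

/-- The pole pair expansion of a block list. [folklore] -/
def polePPoly (bs : List PoleBlk) : SPoly := mergeAll (bs.map polePb)

/-- The triple expansion of a block list. [folklore] -/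
def poleSPoly (bs : List PoleBlk) : SPoly := mergeAll (bs.map poleSb)

/-- Real value of the pole pair expansion. [folklore] -/
def polePval (bs : List PoleBlk) (u v t : ℝ) : ℝ :=
  (bs.map fun b => (b.s : ℝ) * (
    (b.cols.map fun ab => (ab.1.sum : ℝ) * phiW ab.1 t).sum *
        ((cfac3 b.k : ℝ) * Q3 b.k 1 t t + (cfac3 b.k : ℝ) * Q3 b.k t 1 t)
    + (b.cols.map fun ab => phiW ab.1 t * phiW ab.1 t).sum * ((cfac3 b.k : ℝ) * Q3 b.k t t 1)
    + (b.cols.map fun ab => phiW ab.1 t * phiW ab.2 (-u)).sum * ((cfac3 b.k : ℝ) * Q3 b.k t (-u) (-v))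
    + (b.cols.map fun ab => phiW ab.1 t * phiW ab.2 (-v)).sum *
        ((cfac3 b.k : ℝ) * Q3 b.k t (-v) (-u)))).sum

/-- Real value of the triple expansion. [folklore] -/
def poleSval (bs : List PoleBlk) (u v t : ℝ) : ℝ :=
  (bs.map fun b => (b.s : ℝ) * (
    (b.cols.map fun ab => phiW ab.1 u * phiW ab.1 v).sum * ((cfac3 b.k : ℝ) * Q3 b.k u v t)
    + (b.cols.map fun ab => phiW ab.1 u * phiW ab.1 t).sum * ((cfac3 b.k : ℝ) * Q3 b.k u t v)
    + (b.cols.map fun ab => phiW ab.1 v * phiW ab.1 t).sum * ((cfac3 b.k : ℝ) * Q3 b.k v t u))).sum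

/-- `eval (polePb b) = …` (the `b`-summand of `polePval`). [folklore] -/
theorem eval_polePb (b : PoleBlk) (u v t : ℝ) :
    eval (polePb b) u v t = (b.s : ℝ) * (
      (b.cols.map fun ab => (ab.1.sum : ℝ) * phiW ab.1 t).sum *
          ((cfac3 b.k : ℝ) * Q3 b.k 1 t t + (cfac3 b.k : ℝ) * Q3 b.k t 1 t)
      + (b.cols.map fun ab => phiW ab.1 t * phiW ab.1 t).sum * ((cfac3 b.k : ℝ) * Q3 b.k t t 1)
      + (b.cols.map fun ab => phiW ab.1 t * phiW ab.2 (-u)).sum *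
          ((cfac3 b.k : ℝ) * Q3 b.k t (-u) (-v))
      + (b.cols.map fun ab => phiW ab.1 t * phiW ab.2 (-v)).sum *
          ((cfac3 b.k : ℝ) * Q3 b.k t (-v) (-u))) := by
  rw [polePb, eval_smul, eval_mergeAll]
  simp only [List.map_cons, List.map_nil, List.sum_cons, List.sum_nil, add_zero, eval_mulN,
    eval_mergeAll, List.map_map, eval_append, eval_QIsub, eval_C, eval_T, eval_U, eval_V, eval_neg]
  have e1 : (b.cols.map ((fun p => eval p u v t) ∘ fun ab => smul ab.1.sum (phiT ab.1))).sum
      = (b.cols.map fun ab => (ab.1.sum : ℝ) * phiW ab.1 t).sum :=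
    congrArg List.sum (List.map_congr_left fun ab _ => by
      simp only [Function.comp_apply, eval_smul, eval_phiT])
  have e2 : (b.cols.map ((fun p => eval p u v t) ∘ fun ab => mulN (phiT ab.1) (phiT ab.1))).sum
      = (b.cols.map fun ab => phiW ab.1 t * phiW ab.1 t).sum :=
    congrArg List.sum (List.map_congr_left fun ab _ => by
      simp only [Function.comp_apply, eval_mulN, eval_phiT])
  have e3 : (b.cols.map ((fun p => eval p u v t) ∘ fun ab => mulN (phiT ab.1) (phiU (altNeg ab.2)))).sum
      = (b.cols.map fun ab => phiW ab.1 t * phiW ab.2 (-u)).sum :=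
    congrArg List.sum (List.map_congr_left fun ab _ => by
      simp only [Function.comp_apply, eval_mulN, eval_phiT, eval_phiU, phiW_altNeg])
  have e4 : (b.cols.map ((fun p => eval p u v t) ∘ fun ab => mulN (phiT ab.1) (phiV (altNeg ab.2)))).sum
      = (b.cols.map fun ab => phiW ab.1 t * phiW ab.2 (-v)).sum :=
    congrArg List.sum (List.map_congr_left fun ab _ => by
      simp only [Function.comp_apply, eval_mulN, eval_phiT, eval_phiV, phiW_altNeg])
  rw [e1, e2, e3, e4]
  push_cast; ring

/-- `eval (poleSb b) = …` (the `b`-summand of `poleSval`). [folklore] -/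
theorem eval_poleSb (b : PoleBlk) (u v t : ℝ) :
    eval (poleSb b) u v t = (b.s : ℝ) * (
      (b.cols.map fun ab => phiW ab.1 u * phiW ab.1 v).sum * ((cfac3 b.k : ℝ) * Q3 b.k u v t)
      + (b.cols.map fun ab => phiW ab.1 u * phiW ab.1 t).sum * ((cfac3 b.k : ℝ) * Q3 b.k u t v)
      + (b.cols.map fun ab => phiW ab.1 v * phiW ab.1 t).sum * ((cfac3 b.k : ℝ) * Q3 b.k v t u)) := by
  rw [poleSb, eval_smul, eval_mergeAll]
  simp only [List.map_cons, List.map_nil, List.sum_cons, List.sum_nil, add_zero, eval_mulN,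
    eval_mergeAll, List.map_map, eval_QIsub, eval_QI3, eval_T, eval_U, eval_V]
  have e1 : (b.cols.map ((fun p => eval p u v t) ∘ fun ab => mulN (phiU ab.1) (phiV ab.1))).sum
      = (b.cols.map fun ab => phiW ab.1 u * phiW ab.1 v).sum :=
    congrArg List.sum (List.map_congr_left fun ab _ => by
      simp only [Function.comp_apply, eval_mulN, eval_phiU, eval_phiV])
  have e2 : (b.cols.map ((fun p => eval p u v t) ∘ fun ab => mulN (phiU ab.1) (phiT ab.1))).sum
      = (b.cols.map fun ab => phiW ab.1 u * phiW ab.1 t).sum :=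
    congrArg List.sum (List.map_congr_left fun ab _ => by
      simp only [Function.comp_apply, eval_mulN, eval_phiU, eval_phiT])
  have e3 : (b.cols.map ((fun p => eval p u v t) ∘ fun ab => mulN (phiV ab.1) (phiT ab.1))).sum
      = (b.cols.map fun ab => phiW ab.1 v * phiW ab.1 t).sum :=
    congrArg List.sum (List.map_congr_left fun ab _ => by
      simp only [Function.comp_apply, eval_mulN, eval_phiV, eval_phiT])
  rw [e1, e2, e3]
  push_cast; ring

/-- `eval (polePPoly bs) = polePval bs`. [folklore] -/
theorem eval_polePPoly (bs : List PoleBlk) (u v t : ℝ) :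
    eval (polePPoly bs) u v t = polePval bs u v t := by
  rw [polePPoly, eval_mergeAll, List.map_map, polePval]
  exact congrArg List.sum (List.map_congr_left fun b _ => by
    simp only [Function.comp_apply]; rw [eval_polePb])

/-- `eval (poleSPoly bs) = poleSval bs`. [folklore] -/
theorem eval_poleSPoly (bs : List PoleBlk) (u v t : ℝ) :
    eval (poleSPoly bs) u v t = poleSval bs u v t := by
  rw [poleSPoly, eval_mergeAll, List.map_map, poleSval]
  exact congrArg List.sum (List.map_congr_left fun b _ => by
    simp only [Function.comp_apply]; rw [eval_poleSb])

/-- The expansions are additive in the block list (on values). [folklore] -/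
theorem polePval_append (l₁ l₂ : List PoleBlk) (u v t : ℝ) :
    polePval (l₁ ++ l₂) u v t = polePval l₁ u v t + polePval l₂ u v t := by
  simp [polePval, List.map_append, List.sum_append]

/-- The expansions are additive in the block list (on values). [folklore] -/
theorem poleSval_append (l₁ l₂ : List PoleBlk) (u v t : ℝ) :
    poleSval (l₁ ++ l₂) u v t = poleSval l₁ u v t + poleSval l₂ u v t := by
  simp [poleSval, List.map_append, List.sum_append]

/-! ### Chunk checks (pieces of an expansion validated one `decide` at a time) -/

/-- Piece check: `Dprev + piece - Dnext ≡ 0`. [folklore] -/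
def pieceOK (piece Dprev Dnext : SPoly) : Bool := residualBound (Dprev ++ piece ++ neg Dnext) 0

/-- Piece validity on values: `Dnext = Dprev + piece` on the unit box. [folklore] -/
def PieceVal (piece Dprev Dnext : SPoly) : Prop :=
  ∀ u v t : ℝ, |u| ≤ 1 → |v| ≤ 1 → |t| ≤ 1 →
    eval Dnext u v t = eval Dprev u v t + eval piece u v t

/-- A kernel piece check gives piece validity. [folklore] -/
theorem pieceVal_of_ok (piece Dprev Dnext : SPoly) (h : pieceOK piece Dprev Dnext = true) :
    PieceVal piece Dprev Dnext := by
  intro u v t hu hv ht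
  have h0 := abs_eval_le_of_residualBound _ _ h hu hv ht
  rw [eval_append, eval_append, eval_neg] at h0
  have h1 : |Dprev.eval u v t + piece.eval u v t + -Dnext.eval u v t| ≤ 0 := by simpa using h0
  have h2 := abs_nonpos_iff.1 h1
  linarith

/-- Pole-pair chunk validity: `Dnext = Dprev + polePPoly bs` on the unit box. [folklore] -/
def PolePChunkVal (bs : List PoleBlk) (Dprev Dnext : SPoly) : Prop :=
  ∀ u v t : ℝ, |u| ≤ 1 → |v| ≤ 1 → |t| ≤ 1 →
    eval Dnext u v t = eval Dprev u v t + polePval bs u v t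

/-- Triple chunk validity: `Dnext = Dprev + poleSPoly bs` on the unit box. [folklore] -/
def PoleSChunkVal (bs : List PoleBlk) (Dprev Dnext : SPoly) : Prop :=
  ∀ u v t : ℝ, |u| ≤ 1 → |v| ≤ 1 → |t| ≤ 1 →
    eval Dnext u v t = eval Dprev u v t + poleSval bs u v t

/-- A kernel check of a pole-pair chunk. [folklore] -/
theorem polePChunkVal_of_ok (bs : List PoleBlk) (Dprev Dnext : SPoly)
    (h : pieceOK (polePPoly bs) Dprev Dnext = true) : PolePChunkVal bs Dprev Dnext := by
  intro u v t hu hv ht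
  rw [pieceVal_of_ok _ _ _ h u v t hu hv ht, eval_polePPoly]

/-- A kernel check of a triple chunk. [folklore] -/
theorem poleSChunkVal_of_ok (bs : List PoleBlk) (Dprev Dnext : SPoly)
    (h : pieceOK (poleSPoly bs) Dprev Dnext = true) : PoleSChunkVal bs Dprev Dnext := by
  intro u v t hu hv ht
  rw [pieceVal_of_ok _ _ _ h u v t hu hv ht, eval_poleSPoly]

/-- Consecutive pole-pair chunks compose. [folklore] -/
theorem polePChunkVal_append (l₁ l₂ : List PoleBlk) (D0 D1 D2 : SPoly)
    (h1 : PolePChunkVal l₁ D0 D1) (h2 : PolePChunkVal l₂ D1 D2) : PolePChunkVal (l₁ ++ l₂) D0 D2 := by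
  intro u v t hu hv ht
  rw [h2 u v t hu hv ht, h1 u v t hu hv ht, polePval_append]; ring

/-- Consecutive triple chunks compose. [folklore] -/
theorem poleSChunkVal_append (l₁ l₂ : List PoleBlk) (D0 D1 D2 : SPoly)
    (h1 : PoleSChunkVal l₁ D0 D1) (h2 : PoleSChunkVal l₂ D1 D2) : PoleSChunkVal (l₁ ++ l₂) D0 D2 := by
  intro u v t hu hv ht
  rw [h2 u v t hu hv ht, h1 u v t hu hv ht, poleSval_append]; ring

/-- Validity of a pole-pair expansion `PI`: `PI = polePPoly bs` on the unit box. [folklore] -/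
def PolePValid (bs : List PoleBlk) (PI : SPoly) : Prop :=
  ∀ u v t : ℝ, |u| ≤ 1 → |v| ≤ 1 → |t| ≤ 1 → eval PI u v t = polePval bs u v t

/-- Validity of a triple expansion `SI`: `SI = poleSPoly bs` on the unit box. [folklore] -/
def PoleSValid (bs : List PoleBlk) (SI : SPoly) : Prop :=
  ∀ u v t : ℝ, |u| ≤ 1 → |v| ≤ 1 → |t| ≤ 1 → eval SI u v t = poleSval bs u v t

/-- A full-range chunk validity is a validity (pair). [folklore] -/
theorem polePValid_of_chunkVal (bs bs' : List PoleBlk) (PI : SPoly) (hbs : bs' = bs)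
    (h : PolePChunkVal bs' [] PI) : PolePValid bs PI := by
  intro u v t hu hv ht
  rw [h u v t hu hv ht, eval_nil, zero_add, hbs]

/-- A full-range chunk validity is a validity (triple). [folklore] -/
theorem poleSValid_of_chunkVal (bs bs' : List PoleBlk) (SI : SPoly) (hbs : bs' = bs)
    (h : PoleSChunkVal bs' [] SI) : PoleSValid bs SI := by
  intro u v t hu hv ht
  rw [h u v t hu hv ht, eval_nil, zero_add, hbs]

end Summit.Ventures.Crystal3D.X2SOS

end
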